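import Literature.IUT.HodgeArakelov.MonoThetaProjectiveProp16RefTF
import Literature.IUT.HodgeArakelov.MonoThetaProjectiveProp16EllipticRefChain
import Literature.AnabelianGeometry.AbsoluteAnabelian.AbsTopII.EllipticCuspidalizationTFContent
import HarnessLib

/-!
# [IUTchII] Prop. 1.6 (ii): the CHAIN reference clause (R2′) RE-POINTED to the print-faithful [AbsTopII] Cor. 3.3
# record `AbsTopII.EllipticCuspidalizationTF` (finding T1g11-F1 at layer L6; v2 successor + bridges)

Statement-only SUCCESSOR file (one `Prop`-valued structure, one bundled GENUINE structure, two `toTF` bridges, two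
projections; NO edit of any landed module, NO new named fact, NO instance, NO notation) of the abc-iut cell, seat
abc-iut-w5-d033 (gen 16), «L6 ROWS #6» slice (c) of abc-iut-L6-lead §F v1.19eh (A), for the DAG node
**IUTchII:Prop1.6(ii)** (layer L6, OUTSIDE the [IUTchIII] Cor. 3.12 cone); MERGE-MAP §8S row B18; impact census
`HOME/staging/L6/L6-t7/gen8/T1G11-F1-L6-IMPACT.md` (abc-iut-L6-t7).  The four declarations are the chain halves cut
out of abc-iut-L6-t7's slice (a) file `MonoThetaProjectiveProp16RefTF.lean` per the ruling (their staged text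
`MonoThetaProjectiveProp16RefTF.full.lean`, re-typed here with attribution); the chain-content predicate over the TF
record is abc-iut-L4's `AbsTopII.EllipticCuspidalizationTF.RealizesChain` (`EllipticCuspidalizationTFContent.lean`,
L4-lead m172 (4)).

S. Mochizuki, *Inter-universal Teichmüller Theory II*, kurims manuscript (Dec. 2020), §1, Prop. 1.6 (ii) p. 31
l. 34–41: "(Elliptic Cuspidalizations) Let `N` be a positive integer. Then there exists a functorial group-theoretic
algorithm [cf. [AbsTopII], Corollary 3.3, (iii); [AbsTopII], Remark 3.3.3] `Π ↦ {Π_{U_N}(Π) ↠ Π}` … such that when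
`Π = Π^tp_{X̲̲_k}`, the surjection `Π_{U_N}(Π) ↠ Π` may be naturally identified with a certain surjection — i.e.,
“elliptic cuspidalization” — that arises from a certain open immersion determined by the `N`-torsion points of a
once-punctured elliptic curve that forms a double covering of `C_k` [cf. [AbsTopII], Corollary 3.3, (iii)]."
[claim: Mochizuki2012, status: disputed] (IUTchII §1 Prop 1.6 (ii), kurims p.31).  S. Mochizuki, *Topics in Absolute
Anabelian Geometry II*, Cor. 3.3 (iii)(a) p. 68: "a `Π`-chain … of type `⋏, ⋎, ⋏, •, …, •, ⋏, ⋎` … such that the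
natural surjection `Π_U ↠ Π_D` may be recovered from the chain of •'s terminating at the third to last group";
(ii) p. 68: "open subgroups `J ⊆ Π_C` of index `2` such that `J ∩ Δ_C` is torsion-free [i.e., the covering determined
by `J` is a scheme]" [cite: MochizukiAbsTopII2013, Cor 3.3 pp.67-69].

## Why (finding T1g11-F1 at L6, chain half)

abc-iut-L6-t2's v2 successor predicate `EllipticCuspidalization.RefIsEllipticChain` (p450109) quantifies, in its clause
(R2′), `∃ C : AbsTopII.EllipticCuspidalization E` over abc-iut-L4-t6's FROZEN output record, whose clause (ii) is
typed `IsMulTorsionFree ↥(Π_D ⊓ Δ_C)` (UNIQUE ROOTS) and which is UNINHABITED over every extension whose `Δ` is free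
pro-`Σ` of rank `≥ 2` with two primes in `Σ` — so `RefIsEllipticChain` is FALSE and `GenuineChain` EMPTY at every
genuine affine `X̲̲_k` (`Summit.ABC.IUTFork.isEmpty_genuineChain_of_isFreeProOn_deltaHat`, abc-iut-L4-t17 p499351).
The re-point of the v1 clause (R2) and of the core clause is abc-iut-L6-t7's slice (a) (`RefIsEllipticTF`,
`GenuineTF`, …); THIS file re-points (R2′): the record becomes abc-iut-L4-t4's print-faithful
`AbsTopII.EllipticCuspidalizationTF E` ((ii) := `∀ g : ↥(Π_D ⊓ Δ_C), IsOfFinOrder g → g = 1`) and the chain content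
becomes `EllipticCuspidalizationTF.RealizesChain`.

## What is typed (append-only; every other clause VERBATIM)

* `EllipticCuspidalization.RefIsEllipticChainTF K X U eX eU` — EXTENDS slice (a)'s `RefIsEllipticTF` by (R2′-TF)
  `ellipticChain : ∃ E iX (C : AbsTopII.EllipticCuspidalizationTF E) iU, C.N = N ∧ … ∧ ∃ CD hP hΔ hne,
  IsCuspidalDataOf X iX CD ∧ C.RealizesChain C.Sigma CD hP hΔ hne` (abc-iut-L6-t2's clause with the record type and
  the content predicate swapped for their TF successors; `IsCuspidalDataOf` reused BY NAME);
* `EllipticCuspidalization.GenuineChainTF S N P X U eX` — EXTENDS slice (a)'s `GenuineTF` by the v2-TF predicate,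
  decl-for-decl as `GenuineChain`;
* bridges `RefIsEllipticChain.toTF` / `GenuineChain.toTF` (through `RefIsElliptic.toTF` / `Genuine.toTF` of slice (a)
  and abc-iut-L4's `EllipticCuspidalization.realizesChain_toTF_iff`), projections `RefIsEllipticChainTF.refIsEllipticTF`,
  `GenuineChain.toTF_toGenuineTF` (`rfl`).
The API of the v2-TF predicate (ChainProofs ×11 re-derived, non-degeneracy `not_of_completesToIso` /
`not_of_refHom_eq_self` over abc-iut-w5-d033's `EllipticCuspidalizationTF.RealizesChain.proj_not_injective_of_two_le`)
is the proof-only companion `MonoThetaProjectiveProp16RefChainTFProofs.lean` (slice (d2)).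

HONEST SCOPE: a predicate and a structure over interface data; nothing is asserted to be inhabited — inhabiting them
at the [EtTh] model needs the [SemiAnbd] §6 interface data of `U_X` (MERGE-MAP rows 92/141) and a CONSTRUCTED
print-faithful chain-realizing Cor. 3.3 record at `Π̂_X`; the identity-TF record of slice (b) (abc-iut-L6-d7,
`identityRecordTF`) does NOT inhabit the v2-TF predicate for `N ≥ 2` (slice (d2)).  The frozen v2 predicate and
structure are untouched.  Nothing here takes a side on [IUTchIII] Cor. 3.12; typed ≠ proved; re-typed ≠ constructed;
satisfiable ≠ content; nothing here asserts abc proved or refuted.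
-/

open Topology
open scoped Pointwise

universe u

namespace Literature.IUT.HodgeArakelov

open Literature.AnabelianGeometry.SemiGraphs (TemperedCurve)
open Literature.AnabelianGeometry.AbsoluteAnabelian (FundamentalExtension)
open Literature.AnabelianGeometry.AbsoluteAnabelian.FundamentalExtension (CuspidalData)
open Literature.AlgebraicGeometry.Frobenioids (IsSlimGroup)

/-! ## Prop. 1.6 (ii), v2: the chain reference clause over the TF record -/

namespace EllipticCuspidalization

section Ref

variable {S : ThetaSetting.{u}} {N : ℕ+} {P : TopGroup.{u}} {p : ℕ} [Fact p.Prime]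
  (K : EllipticCuspidalization S N P) (X U : TemperedCurve p)
  (eX : X.PiTemp ≃ₜ* S.PiX) (eU : U.PiTemp ≃ₜ* K.PiURef)

/-- **THE SUCCESSOR PREDICATE of IUTchII:Prop1.6(ii), v2 WITH THE CHAIN CONTENT, in the print-faithful currency
(finding T1g11-F1).** abc-iut-L6-t2's `RefIsEllipticChain` re-pointed: it EXTENDS abc-iut-L6-t7's `RefIsEllipticTF`
((R0) "`Π = Π^tp_{X̲̲_k}`", (R1) tempered cuspidalisation over the augmentations with `DLoc` kernel and removed cusps
over NON-cuspidal points, (R2-TF) a print-faithful [AbsTopII] Cor. 3.3 (iii) record of level `N` at `Π̂_X`) by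
(R2′-TF): a print-faithful record of level `N` over `E ≅ Π̂_X` (matching `Δ̂_X`), identified with the completion of
`Π^tp_U ↠ Π^tp_X`, which REALIZES THE PRINTED CHAIN of [AbsTopII] Cor. 3.3 (iii)(a) ("a `Π`-chain … of type
`⋏, ⋎, ⋏, •, …, •, ⋏, ⋎` … such that the natural surjection `Π_U ↠ Π_D` may be recovered from the chain of •'s")
relative to cuspidal data that IS the cuspidal data of `X` (`IsCuspidalDataOf`) — abc-iut-L4's
`EllipticCuspidalizationTF.RealizesChain`.  A `Prop`; never asserted; to be inhabited at genuine models and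
consumed BY NAME. [cite: MochizukiAbsTopII2013, Cor 3.3 (iii)(a) p.68]
[claim: Mochizuki2012, status: disputed] (IUTchII §1 Prop 1.6 (ii), kurims p.31) -/
structure RefIsEllipticChainTF : Prop extends K.RefIsEllipticTF X U eX eU where
  /-- (R2′-TF) a print-faithful Cor. 3.3 (iii) record of level `N` over `E ≅ Π̂_X` (matching `Δ̂_X`), identified with
  the completion of `Π^tp_U ↠ Π^tp_X`, which REALIZES THE PRINTED CHAIN relative to the cuspidal data of `X` -/
  ellipticChain : ∃ (E : FundamentalExtension.{0}) (iX : X.PiHat ≃ₜ* E.arith)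
      (C : Literature.AnabelianGeometry.AbsoluteAnabelian.AbsTopII.EllipticCuspidalizationTF E)
      (iU : U.PiHat ≃ₜ* C.cuspUX.arith),
    C.N = (N : ℕ) ∧ (∀ z : X.PiHat, iX z ∈ E.geom ↔ z ∈ X.DeltaHat) ∧
      (∀ y : U.PiTemp, C.proj.arith (iU (U.toHat y)) = iX (X.toHat (K.refHom X U eX eU y))) ∧
      ∃ (CD : CuspidalData E) (hP : IsSlimGroup E.arith) (hΔ : IsSlimGroup E.geom) (hne : E.geom ≠ ⊥),
        IsCuspidalDataOf X iX CD ∧ C.RealizesChain C.Sigma CD hP hΔ hne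

variable {K X U eX eU}

/-- **Bridge, v2 (finding T1g11-F1):** the frozen-currency chain predicate implies the print-faithful one — the v1
part through abc-iut-L6-t7's `RefIsElliptic.toTF`, the chain clause by mapping the (R2′) record through
`AbsTopII.EllipticCuspidalization.toTF` (all fields the clause reads are copied: `N`, `cuspUX`, `proj`, `Sigma`) and
abc-iut-L4's `EllipticCuspidalization.realizesChain_toTF_iff` (`Iff.rfl`).
[claim: Mochizuki2012, status: disputed] (IUTchII §1 Prop 1.6 (ii), kurims p.31) -/
theorem RefIsEllipticChain.toTF (h : K.RefIsEllipticChain X U eX eU) : K.RefIsEllipticChainTF X U eX eU where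
  toRefIsEllipticTF := h.toRefIsElliptic.toTF
  ellipticChain := by
    obtain ⟨E, iX, C, iU, hN, hgeom, hsq, CD, hP, hΔ, hne, hCD, hchain⟩ := h.ellipticChain
    exact ⟨E, iX, C.toTF, iU, hN, hgeom, hsq, CD, hP, hΔ, hne, hCD,
      (C.realizesChain_toTF_iff C.Sigma CD hP hΔ hne).2 hchain⟩

/-- The v2-TF predicate refines the v1-TF predicate of slice (a) (projection).
[claim: Mochizuki2012, status: disputed] (IUTchII §1 Prop 1.6 (ii), kurims p.31) -/
theorem RefIsEllipticChainTF.refIsEllipticTF (h : K.RefIsEllipticChainTF X U eX eU) : K.RefIsEllipticTF X U eX eU :=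
  h.toRefIsEllipticTF

end Ref

end EllipticCuspidalization

/-! ## Prop. 1.6 (ii), v2: the GENUINE output structure over the chain-TF predicate -/

/-- **IUTchII:Prop1.6(ii), GENUINE OUTPUT v2 in the print-faithful currency (finding T1g11-F1)**: abc-iut-L6-t7's
`GenuineTF` (the frozen output `EllipticCuspidalization S N P` extended by `eU : Π^tp_U ≃ₜ* PiURef` and the v1-TF
predicate) FURTHER constrained by the chain content (R2′-TF), decl-for-decl as abc-iut-L6-t2's `GenuineChain` —
"when `Π = Π^tp_{X̲̲_k}`, the surjection `Π_{U_N}(Π) ↠ Π` may be naturally identified with … “elliptic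
cuspidalization” … determined by the `N`-torsion points of a once-punctured elliptic curve".  A structure over the
tree's interfaces; never asserted to be inhabited. [claim: Mochizuki2012, status: disputed] (IUTchII §1 Prop 1.6 (ii), kurims p.31) -/
structure EllipticCuspidalization.GenuineChainTF (S : ThetaSetting.{u}) (N : ℕ+) (P : TopGroup.{u})
    {p : ℕ} [Fact p.Prime] (X U : TemperedCurve p) (eX : X.PiTemp ≃ₜ* S.PiX)
    extends EllipticCuspidalization.GenuineTF S N P X U eX where
  /-- the reference surjection IS the elliptic cuspidalisation of level `N` AND its print-faithful Cor. 3.3 (iii)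
  record realizes the printed chain relative to the cusps of `X` -/
  refIsEllipticChainTF : toEllipticCuspidalization.RefIsEllipticChainTF X U eX eU

namespace EllipticCuspidalization

variable {S : ThetaSetting.{u}} {N : ℕ+} {P : TopGroup.{u}} {p : ℕ} [Fact p.Prime] {X U : TemperedCurve p}
  {eX : X.PiTemp ≃ₜ* S.PiX}

/-- **Bridge, v2 (finding T1g11-F1):** a v2 genuine output in the frozen currency is one in the print-faithful currency
(same output, same `eU`; v1 part through abc-iut-L6-t7's `Genuine.toTF`).
[claim: Mochizuki2012, status: disputed] (IUTchII §1 Prop 1.6 (ii), kurims p.31) -/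
def GenuineChain.toTF (G : EllipticCuspidalization.GenuineChain S N P X U eX) :
    EllipticCuspidalization.GenuineChainTF S N P X U eX where
  toGenuineTF := G.toGenuine.toTF
  refIsEllipticChainTF := G.refIsEllipticChain.toTF

/-- `GenuineChain.toTF` keeps the underlying v1-TF genuine output (hence the frozen output and `eU`).
[claim: Mochizuki2012, status: disputed] (IUTchII §1 Prop 1.6 (ii), kurims p.31) -/
theorem GenuineChain.toTF_toGenuineTF (G : EllipticCuspidalization.GenuineChain S N P X U eX) :
    G.toTF.toGenuineTF = G.toGenuine.toTF := rfl

/-- … in particular the underlying frozen output is unchanged.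
[claim: Mochizuki2012, status: disputed] (IUTchII §1 Prop 1.6 (ii), kurims p.31) -/
theorem GenuineChain.toTF_toEllipticCuspidalization (G : EllipticCuspidalization.GenuineChain S N P X U eX) :
    G.toTF.toEllipticCuspidalization = G.toEllipticCuspidalization := rfl

end EllipticCuspidalization

end Literature.IUT.HodgeArakelov
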